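import Mathlib
import Literature.Geometry.Symplectic.JHolomorphicMap

/-!
# Stub `stub_farInverse` of line `Sketch` for crux `TameOrBrodyR4` (stmt-SmoothPoincare4-7826, route SullivanDual)

The far inverse of `P ∘ u` for a pencil member. Setting: `ℝ⁴ = EuclideanSpace ℝ (Fin 4)`, a
real-linear coordinate `P : ℝ⁴ →L[ℝ] ℂ` with `|P x| ≤ ‖x‖`, and a family `J x : ℝ⁴ →L[ℝ] ℝ⁴` which
is standard in the `P`-direction where `‖x‖ ≥ R`, in the sense `P (J x v) = i P v`. For an entire
`C^∞` flat-`J`-holomorphic `u : ℂ → ℝ⁴` (`du(ξ)(i ζ) = J (u ξ) (du(ξ) ζ)`), normalised by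
`P (u ξ) - ξ → 0` at infinity, crossing every far line `{P = c}`, `|c| > 2R`, at exactly one
parameter and with bijective real differential of `h = P ∘ u` wherever `|h| > 2R`, we prove:
`h` is complex differentiable wherever `‖u‖ > R`; the inverse `ψ` of `h` on `{|c| > 2R}` is
holomorphic and injective there, `h ∘ ψ = id` on `{|c| > 2R}`, `ψ ∘ h = id` on `{|h| > 2R}`,
`ψ c - c → 0` at infinity; and some parameter `p` has `|h p| ≤ 2R`.

How.
* `FarInverse.differentiableAt_comp`: `h = P ∘ u` is complex differentiable at every `ξ` with
  `R ≤ ‖u ξ‖`, since its real derivative `P ∘ du(ξ)` commutes with `i` there,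
  `dh(ξ)(i ζ) = P (J (u ξ) (du(ξ) ζ)) = i dh(ξ) ζ`, and a real-linear `ℂ → ℂ` commuting with `i`
  is complex linear (`Literature.Geometry.Symplectic.exists_restrictScalars_eq_of_map_mul_I` with
  `differentiableAt_iff_restrictScalars`; the same Cauchy–Riemann step as
  `ConfineQ.differentiableAt_of_fderiv_mul_I` of the landed `stub_confineQ`).
* `FarInverse.exists_inverse` (pure one-variable complex analysis): for a continuous `h : ℂ → ℂ`,
  complex differentiable with `h' ≠ 0` wherever `T < |h|` (`0 ≤ T`), with `h ξ - ξ → 0` at infinity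
  and `h ⁻¹ {c}` a singleton for `T < |c|`, the inverse `ψ = Function.invFun h` satisfies
  `h (ψ c) = c` (`T < |c|`), `ψ (h ξ) = ξ` (`T < |h ξ|`, uniqueness), is injective on `{T < |c|}`,
  is complex differentiable there by the strict inverse function theorem
  (`HasStrictDerivAt.to_local_left_inverse`: `h` is analytic on the open set `{T < |h|}` and `ψ` is
  a left inverse of `h` near `ψ c`), tends to infinity at infinity (`h` is bounded on closed balls
  and `h (ψ c) = c`), so `ψ c - c = -(h (ψ c) - ψ c) → 0`; and if `T < |h|` everywhere then `h - id`
  is entire and tends to `0` at infinity, hence vanishes (Liouville,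
  `Differentiable.apply_eq_of_tendsto_cocompact`), so `h 0 = 0`, contradicting `T < |h 0|`.
* In `stub_farInverse`, `h' ξ ≠ 0` where `2R < |h ξ|` because the real differential
  `dh(ξ) = h'(ξ) • 1` (`HasDerivAt.complexToReal_fderiv`) is bijective by hypothesis.

Sources: classical — L. V. Ahlfors, *Complex Analysis* (3rd ed., McGraw-Hill, 1979), Ch. 4 §3.3
(inverse of an injective analytic function) and Ch. 4 §2.3 (Liouville); M. Gromov, Invent. Math. 82
(1985), §2.4.A (pencils of `J`-planes standard at infinity). No `J`-curve theory beyond the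
definition is used.
-/

-- the registered namespace `Summit.SmoothPoincare4.SmoothPoincare4.…` repeats a component
set_option linter.dupNamespace false

noncomputable section

open scoped ContDiff Topology
open Filter Set Metric Literature.Geometry.Symplectic

namespace Summit.SmoothPoincare4.SmoothPoincare4.Cruxes.TameOrBrodyR4.Sketch

local notation "E4" => EuclideanSpace ℝ (Fin 4)

namespace FarInverse

/-- **`P ∘ u` is holomorphic where `J` is standard in the `P`-direction.** If `P (J x v) = i P v`
whenever `R ≤ ‖x‖`, `u : ℂ → E` is real differentiable and flat-`J`-holomorphic, and `R ≤ ‖u ξ‖`,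
then `ξ ↦ P (u ξ)` is complex differentiable at `ξ`: its real derivative `P ∘ du(ξ)` commutes with
`i`, as `P (du(ξ)(i ζ)) = P (J (u ξ) (du(ξ) ζ)) = i P (du(ξ) ζ)`. -/
theorem differentiableAt_comp {E : Type*} [NormedAddCommGroup E] [NormedSpace ℝ E]
    (J : E → E →L[ℝ] E) (R : ℝ) (P : E →L[ℝ] ℂ)
    (hJP : ∀ x : E, R ≤ ‖x‖ → ∀ v, P (J x v) = Complex.I * P v)
    (u : ℂ → E) (hu : Differentiable ℝ u) (huJ : IsJHolomorphicFlat J u)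
    (ξ : ℂ) (hξ : R ≤ ‖u ξ‖) : DifferentiableAt ℂ (fun ξ => P (u ξ)) ξ := by
  have hd : HasFDerivAt (fun ξ => P (u ξ)) (P.comp (fderiv ℝ u ξ)) ξ :=
    P.hasFDerivAt.comp ξ (hu ξ).hasFDerivAt
  rw [differentiableAt_iff_restrictScalars ℝ hd.differentiableAt, hd.fderiv]
  refine exists_restrictScalars_eq_of_map_mul_I _ fun ζ => ?_
  rw [ContinuousLinearMap.comp_apply, ContinuousLinearMap.comp_apply, huJ ξ ζ, hJP _ hξ,
    smul_eq_mul]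

/-- **The far inverse of a normalised proper map (one complex variable).** Let `h : ℂ → ℂ` be
continuous, complex differentiable with `h' ξ ≠ 0` wherever `T < |h ξ|` (`0 ≤ T`), with
`h ξ - ξ → 0` at infinity, and such that every `c` with `T < |c|` has exactly one preimage. Then
there is `ψ : ℂ → ℂ`, holomorphic and injective on `{T < |c|}`, with `h (ψ c) = c` for `T < |c|`,
`ψ (h ξ) = ξ` for `T < |h ξ|`, `ψ c - c → 0` at infinity; and some `p` has `|h p| ≤ T` (else
`h - id` would be entire and tend to `0`, hence vanish by Liouville, but then `h 0 = 0`). The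
holomorphy of `ψ = h⁻¹` is the strict inverse function theorem
(`HasStrictDerivAt.to_local_left_inverse`) at `ψ c`, where `h` is analytic (it is complex
differentiable on the open set `{T < |h|}`) and `ψ ∘ h = id` nearby. -/
theorem exists_inverse {T : ℝ} (hT : 0 ≤ T) {h : ℂ → ℂ} (hcont : Continuous h)
    (hhol : ∀ ξ : ℂ, T < ‖h ξ‖ → DifferentiableAt ℂ h ξ)
    (h6 : Tendsto (fun ξ => h ξ - ξ) (cocompact ℂ) (𝓝 0))
    (h7 : ∀ c : ℂ, T < ‖c‖ → ∃! ξ, h ξ = c)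
    (h8 : ∀ ξ : ℂ, T < ‖h ξ‖ → deriv h ξ ≠ 0) :
    ∃ ψ : ℂ → ℂ, DifferentiableOn ℂ ψ {c : ℂ | T < ‖c‖} ∧ Set.InjOn ψ {c : ℂ | T < ‖c‖} ∧
      (∀ c : ℂ, T < ‖c‖ → h (ψ c) = c) ∧
      (∀ ξ : ℂ, T < ‖h ξ‖ → ψ (h ξ) = ξ) ∧
      Tendsto (fun c => ψ c - c) (cocompact ℂ) (𝓝 0) ∧
      (∃ p : ℂ, ‖h p‖ ≤ T) := by
  classical
  set ψ : ℂ → ℂ := Function.invFun h with hψ_def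
  -- right inverse on `{T < |c|}` (existence) and left inverse on `{T < |h|}` (uniqueness)
  have h3 : ∀ c : ℂ, T < ‖c‖ → h (ψ c) = c := fun c hc => Function.invFun_eq (h7 c hc).exists
  have h4 : ∀ ξ : ℂ, T < ‖h ξ‖ → ψ (h ξ) = ξ := fun ξ hξ =>
    (h7 (h ξ) hξ).unique (h3 (h ξ) hξ) rfl
  -- `h` is holomorphic on the open set `{T < |h|}`
  have hopen : IsOpen {ξ : ℂ | T < ‖h ξ‖} := isOpen_lt continuous_const hcont.norm
  have hdiffOn : DifferentiableOn ℂ h {ξ : ℂ | T < ‖h ξ‖} := fun ξ hξ =>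
    (hhol ξ hξ).differentiableWithinAt
  refine ⟨ψ, ?_, ?_, h3, h4, ?_, ?_⟩
  · -- holomorphy of `ψ`: strict inverse function theorem at `ψ c`
    intro c hc
    have hc' : T < ‖c‖ := hc
    have hξ₀ : h (ψ c) = c := h3 c hc'
    have hfar : T < ‖h (ψ c)‖ := by rw [hξ₀]; exact hc'
    have han : AnalyticAt ℂ h (ψ c) := hdiffOn.analyticAt (hopen.mem_nhds hfar)
    have hstrict : HasStrictDerivAt h (deriv h (ψ c)) (ψ c) := han.hasStrictDerivAt
    have hleft : ∀ᶠ x in 𝓝 (ψ c), ψ (h x) = x := by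
      filter_upwards [hopen.mem_nhds hfar] with x hx using h4 x hx
    have hψ : DifferentiableAt ℂ ψ (h (ψ c)) :=
      (hstrict.to_local_left_inverse (h8 _ hfar) hleft).hasDerivAt.differentiableAt
    rw [hξ₀] at hψ
    exact hψ.differentiableWithinAt
  · -- injectivity on `{T < |c|}`: `h ∘ ψ = id` there
    intro c₁ hc₁ c₂ hc₂ heq
    calc c₁ = h (ψ c₁) := (h3 c₁ hc₁).symm
      _ = h (ψ c₂) := by rw [heq]
      _ = c₂ := h3 c₂ hc₂
  · -- `ψ c - c → 0`: first `ψ → ∞`, then `ψ c - c = -(h (ψ c) - ψ c)` for `T < |c|`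
    have hψinf : Tendsto ψ (cocompact ℂ) (cocompact ℂ) := by
      rw [← cobounded_eq_cocompact, ← tendsto_norm_atTop_iff_cobounded, Filter.tendsto_atTop]
      intro r
      obtain ⟨M, hM⟩ : ∃ M, ∀ ξ ∈ closedBall (0 : ℂ) r, ‖h ξ‖ ≤ M :=
        (isCompact_closedBall 0 r).exists_bound_of_continuousOn hcont.continuousOn
      filter_upwards [tendsto_norm_cobounded_atTop.eventually (eventually_gt_atTop (max T M))]
        with c hc
      have hcT : T < ‖c‖ := (le_max_left _ _).trans_lt hc
      have hcM : M < ‖c‖ := (le_max_right _ _).trans_lt hc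
      by_contra hlt
      have hmem : ψ c ∈ closedBall (0 : ℂ) r := mem_closedBall_zero_iff.2 (not_le.1 hlt).le
      have hle := hM (ψ c) hmem
      rw [h3 c hcT] at hle
      exact absurd (hle.trans_lt hcM) (lt_irrefl _)
    have hcomp : Tendsto (fun c => h (ψ c) - ψ c) (cocompact ℂ) (𝓝 0) := h6.comp hψinf
    have hneg : Tendsto (fun c => ψ c - h (ψ c)) (cocompact ℂ) (𝓝 0) := by
      have hn := hcomp.neg
      rw [neg_zero] at hn
      exact hn.congr fun c => neg_sub _ _
    have hev : ∀ᶠ c in cocompact ℂ, T < ‖c‖ := by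
      rw [← cobounded_eq_cocompact]
      exact tendsto_norm_cobounded_atTop.eventually (eventually_gt_atTop T)
    refine hneg.congr' ?_
    filter_upwards [hev] with c hc
    rw [h3 c hc]
  · -- an omitted far value: else `h - id` is entire, tends to `0`, so `h = id`, but `T < |h 0|`
    by_contra hcon
    push Not at hcon
    have hd : Differentiable ℂ h := fun ξ => hhol ξ (hcon ξ)
    have hg : Differentiable ℂ (fun ξ => h ξ - ξ) := hd.sub differentiable_fun_id
    have h0 : h 0 - 0 = 0 := hg.apply_eq_of_tendsto_cocompact 0 h6
    rw [sub_zero] at h0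
    have hlt : T < ‖h 0‖ := hcon 0
    rw [h0, norm_zero] at hlt
    exact absurd hlt (not_lt.2 hT)

end FarInverse

/-- **Stub (classical): the far inverse of `P ∘ u`.** For an entire `C^∞` flat-`J`-holomorphic
`u` with `P ∘ J = i P` where `‖x‖ ≥ R` (`|P x| ≤ ‖x‖`), normalised (`P (u ξ) - ξ → 0`) and crossing
the far lines `{P = c}`, `|c| > 2R`, once with bijective differential: `P ∘ u` is complex
differentiable wherever `‖u‖ > R`; its inverse `ψ` on `{|c| > 2R}` is holomorphic and injective there,
with `ψ(c) - c → 0`; and some parameter `p` has `|P (u p)| ≤ 2R` (else `P ∘ u - id` would be an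
entire function tending to `0` at infinity, hence `P ∘ u = id` by Liouville, but `|P (u 0)| > 2R`). -/
theorem stub_farInverse (J : E4 → E4 →L[ℝ] E4) (R : ℝ) (hR : 0 < R) (P : E4 →L[ℝ] ℂ)
    (hP : ∀ x : E4, ‖P x‖ ≤ ‖x‖)
    (hJP : ∀ x : E4, R ≤ ‖x‖ → ∀ v, P (J x v) = Complex.I * P v)
    (u : ℂ → E4) (hu : ContDiff ℝ ∞ u) (huJ : IsJHolomorphicFlat J u)
    (h6 : Tendsto (fun ξ => P (u ξ) - ξ) (cocompact ℂ) (𝓝 0))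
    (h7 : ∀ c : ℂ, 2 * R < ‖c‖ → ∃! ξ, P (u ξ) = c)
    (h8 : ∀ ξ : ℂ, 2 * R < ‖P (u ξ)‖ → Function.Bijective (fderiv ℝ (fun ξ => P (u ξ)) ξ)) :
    ∃ ψ : ℂ → ℂ, DifferentiableOn ℂ ψ {c : ℂ | 2 * R < ‖c‖} ∧ Set.InjOn ψ {c : ℂ | 2 * R < ‖c‖} ∧
      (∀ c : ℂ, 2 * R < ‖c‖ → P (u (ψ c)) = c) ∧
      (∀ ξ : ℂ, 2 * R < ‖P (u ξ)‖ → ψ (P (u ξ)) = ξ) ∧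
      Tendsto (fun c => ψ c - c) (cocompact ℂ) (𝓝 0) ∧
      (∀ ξ : ℂ, R < ‖u ξ‖ → DifferentiableAt ℂ (fun ξ => P (u ξ)) ξ) ∧
      (∃ p : ℂ, ‖P (u p)‖ ≤ 2 * R) := by
  have hud : Differentiable ℝ u := hu.differentiable (by simp)
  have hcont : Continuous fun ξ => P (u ξ) := P.continuous.comp hu.continuous
  -- holomorphy of `P ∘ u` wherever `R ≤ ‖u‖`
  have hhol : ∀ ξ : ℂ, R ≤ ‖u ξ‖ → DifferentiableAt ℂ (fun ξ => P (u ξ)) ξ := fun ξ hξ =>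
    FarInverse.differentiableAt_comp J R P hJP u hud huJ ξ hξ
  -- far parameters lie in the standard region: `2R < |P (u ξ)| ≤ ‖u ξ‖`
  have hfar : ∀ ξ : ℂ, 2 * R < ‖P (u ξ)‖ → R ≤ ‖u ξ‖ := fun ξ hξ => by
    have hle := hP (u ξ)
    linarith
  -- non-vanishing complex derivative where the real differential is bijective
  have h8' : ∀ ξ : ℂ, 2 * R < ‖P (u ξ)‖ → deriv (fun ξ => P (u ξ)) ξ ≠ 0 := by
    intro ξ hξ h0
    have hfd : HasFDerivAt (fun ξ => P (u ξ))
        (deriv (fun ξ => P (u ξ)) ξ • (1 : ℂ →L[ℝ] ℂ)) ξ :=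
      (hhol ξ (hfar ξ hξ)).hasDerivAt.complexToReal_fderiv
    have key : ∀ z : ℂ, fderiv ℝ (fun ξ => P (u ξ)) ξ z = 0 := fun z => by
      rw [hfd.fderiv, smul_apply, h0, zero_smul]
    exact one_ne_zero ((h8 ξ hξ).1 (by rw [key 1, key 0]))
  obtain ⟨ψ, h1, h2, h3, h4, h5, h9⟩ :=
    FarInverse.exists_inverse (T := 2 * R) (h := fun ξ => P (u ξ)) (by positivity) hcont
      (fun ξ hξ => hhol ξ (hfar ξ hξ)) h6 h7 h8'
  exact ⟨ψ, h1, h2, h3, h4, h5, fun ξ hξ => hhol ξ hξ.le, h9⟩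

end Summit.SmoothPoincare4.SmoothPoincare4.Cruxes.TameOrBrodyR4.Sketch
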